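import Literature.NumberTheory.Automorphic.HeckeFixedVectorsIntertwiners
import HarnessLib

/-!
# Extension of Hecke-module maps on `K`-fixed vectors to intertwiners, from LEVELWISE semisimplicity
# (Bump, Prop. 4.2.3 (b) without a `G`-stable complement)

Topic `NumberTheory/Automorphic`; namespace `Literature.NumberTheory.Automorphic`.  THEOREMS ONLY (no definition, no named fact,
no instance, no `sorry`); Mathlib + ★ `HeckeFixedVectorsIntertwiners` / `HeckeFixedVectorsSpan` / `HeckeAlgebra`.

★ `HeckeFixedVectorsIntertwiners.exists_intertwiningMap_extending` proves the surjectivity half of [Bump1997] Prop. 4.2.3 /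
[BushnellHenniart2006] §4.3 Proposition (2) — every Hecke-equivariant `L : W^K → V^K` out of an IRREDUCIBLE `(ρ, W)` is the restriction
of an intertwiner `W → V` — assuming `(σ, V)` SEMISIMPLE as a `G`-representation (a `G`-stable complement is taken).  This file proves
the same conclusion from a LEVELWISE hypothesis only: `V` is the union of its fixed spaces `V^{K′}` over a family `𝓛` of subgroups
`K′ ≤ K` normalised by `K` with finite double cosets, and for each `K′ ∈ 𝓛` every subspace of `V^{K′}` stable under the Hecke operators
`[K′gK′]` has a stable complement in `V^{K′}` («`V^{K′}` is a semisimple `ℋ(G,K′)`-module» — e.g. because the image of `ℋ(G,K′)` in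
`End V^{K′}` is a semisimple ring).

* `heckeOperator_apply_of_forall_mem` — if `c` normalises `K′` then `[K′cK′] = σ(c)` on `V^{K′}` (one coset).
* **`exists_intertwiningMap_extending_of_levelwise`**.  PROOF ([BushnellHenniart2006] §4.2 Lemma «`(ℋ(G)v)^K = ℋ(G,K)v`» = ★
  `span_translates_inf_fixedPoints_of_stable`, twice).  As in ★ `exists_intertwiningMap_extending`: the graph `Γ` of `L` on `W^K` is a
  Hecke-stable subspace of `(W ⊕ V)^K`, its `G`-span `U` has `U^K = Γ`, the first projection `U → W` is onto, and its kernel is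
  `0 ⊕ V′` with `V′ ≤ V` a subrepresentation without `K`-fixed vectors.  Instead of complementing `V′` we show **`V′ = 0`**: `V′` lies in
  `S := k[G]·L(W^K)`; for `K′ ∈ 𝓛` let `N := V′ ∩ V^{K′}` and `C` a Hecke-stable complement of `N` in `V^{K′}`; since `K` normalises
  `K′` it acts on `V^{K′}` through the Hecke operators `[K′cK′] = σ(c)`, so `N` and `C` are `K`-stable and the `N`-component of a
  `K`-fixed vector of `S` is `K`-fixed, i.e. lies in `V′^K = 0`: `S^K ⊆ C`.  Hence `L(W^K) ⊆ T := C ∩ S^{K′}`, a Hecke_{K′}-stable subspace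
  of `V^{K′}`, so `S ⊆ k[G]·T` and `N ⊆ S^{K′} ⊆ (k[G]·T)^{K′} = T ⊆ C`, whence `N = 0`; as `V = ⋃ V^{K′}`, `V′ = 0`, `U` is the
  graph of a linear map `f : W → V`, which is the intertwiner sought.

Cell `hodgecm-mathlib` (d6 S2′): this is the «S1c eliminator» — with `σ = ℚ̄_ℓ ⊗ H¹_ét(A_∞)` and `𝓛` the small levels `K′ ⊴ K`, the
levelwise hypothesis is «`heckeImage K′` is a semisimple ring for every `K′`» (road (P): Rosati), and the `G`-level semisimplicity binder of
★ `OmegaHomIsotypic` / ★ `OmegaHomIsotypicComponent` / ★ `OmegaHomBlockFieldCharacter` becomes unnecessary.  Count-neutral (HC_CM is proved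
only modulo the 7 printed citations until rung 0 closes).

## References
* [Bump1997] D. Bump, *Automorphic Forms and Representations*, CUP 1997 — Prop. 4.2.3 (p. 427).
* [BushnellHenniart2006] C. J. Bushnell, G. Henniart, *The Local Langlands Conjecture for GL(2)*, Springer 2006 — §4.2 Lemma (p. 35),
  §4.3 Proposition (2) and its proof (pp. 38–39).
-/

set_option autoImplicit false

namespace Literature.NumberTheory.Automorphic

open MulAction

section Levelwise

variable {k G V W : Type*} [Field k] [CharZero k] [Group G] [AddCommGroup V] [Module k V] [AddCommGroup W] [Module k W]
  (ρ : Representation k G W) (σ : Representation k G V) (K : Subgroup G)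

omit [CharZero k] in
/-- **The Hecke operator of a normalising element**: if `c⁻¹ K′ c ⊆ K′` then `K′cK′ = cK′` is a single coset and `[K′cK′] v = σ(c) v`
for `v ∈ V^{K′}`. [cite: BushnellHenniart2006, §4.2 Lemma (p. 35)] -/
theorem heckeOperator_apply_of_forall_mem {K' : Subgroup G} {c : G} (hc : ∀ x ∈ K', c⁻¹ * x * c ∈ K') {v : V}
    (hv : v ∈ σ.fixedPoints K') : heckeOperator σ K' c v = σ c v := by
  have horb : orbit K' (c : G ⧸ K') = {(c : G ⧸ K')} := by
    ext y
    simp only [mem_orbit_iff, Set.mem_singleton_iff]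
    constructor
    · rintro ⟨x, rfl⟩
      change (((x : G) * c : G) : G ⧸ K') = _
      rw [QuotientGroup.eq, mul_inv_rev]
      exact hc _ (inv_mem x.2)
    · rintro rfl
      exact ⟨1, one_smul _ _⟩
  rw [heckeOperator, horb, finsum_mem_singleton]
  obtain ⟨h, H⟩ := QuotientGroup.mk_out_eq_mul K' c
  rw [H, map_mul, Module.End.mul_apply, (σ.mem_fixedPoints K' v).1 hv _ h.2]

/-- **LEVELWISE EXTENSION THEOREM** (surjectivity of `Hom_G(W, V) → Hom_{ℋ(G,K)}(W^K, V^K)` from levelwise semisimplicity).  Let `k`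
have characteristic zero, `KgK/K` finite for all `g`, `(ρ, W)` IRREDUCIBLE; let `𝓛` be a family of subgroups `K′ ≤ K` normalised by `K`
with `K′gK′/K′` finite, such that every vector of `V` is fixed by some `K′ ∈ 𝓛` and, for each `K′ ∈ 𝓛`, every subspace of `V^{K′}`
stable under all `[K′gK′]` has a stable complement in `V^{K′}`.  If a `k`-linear `L : W → V` maps `W^K` into `V^K` and commutes there
with every `[KgK]`, then some intertwiner `f : W → V` agrees with `L` on `W^K`.
[cite: Bump1997, Prop. 4.2.3] [cite: BushnellHenniart2006, §4.2 Lemma (p. 35) and §4.3 Proposition (2) (pp. 38–39)] -/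
theorem exists_intertwiningMap_extending_of_levelwise [ρ.IsIrreducible]
    (hfin : ∀ g : G, (orbit K (g : G ⧸ K)).Finite)
    (𝓛 : Set (Subgroup G)) (h𝓛K : ∀ K' ∈ 𝓛, K' ≤ K) (h𝓛n : ∀ K' ∈ 𝓛, ∀ c ∈ K, ∀ x ∈ K', c⁻¹ * x * c ∈ K')
    (h𝓛fin : ∀ K' ∈ 𝓛, ∀ g : G, (orbit K' (g : G ⧸ K')).Finite)
    (hsm : ∀ v : V, ∃ K' ∈ 𝓛, v ∈ σ.fixedPoints K')
    (hss : ∀ K' ∈ 𝓛, ∀ N : Submodule k V, N ≤ σ.fixedPoints K' → (∀ g : G, ∀ n ∈ N, heckeOperator σ K' g n ∈ N) →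
      ∃ C : Submodule k V, C ≤ σ.fixedPoints K' ∧ (∀ g : G, ∀ c ∈ C, heckeOperator σ K' g c ∈ C) ∧
        N ⊓ C = ⊥ ∧ N ⊔ C = σ.fixedPoints K')
    (L : W →ₗ[k] V) (hLK : ∀ w ∈ ρ.fixedPoints K, L w ∈ σ.fixedPoints K)
    (hL : ∀ g : G, ∀ w ∈ ρ.fixedPoints K, L (heckeOperator ρ K g w) = heckeOperator σ K g (L w)) :
    ∃ f : ρ.IntertwiningMap σ, ∀ w ∈ ρ.fixedPoints K, f w = L w := by
  classical
  -- the graph of `L` on `W^K`, a Hecke-stable subspace of `(W ⊕ V)^K`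
  set τ : Representation k G (W × V) := ρ.prod σ with hτ
  set Γ : Submodule k (W × V) := (ρ.fixedPoints K).map ((LinearMap.id : W →ₗ[k] W).prod L) with hΓ
  have hΓmem : ∀ x : W × V, x ∈ Γ ↔ x.1 ∈ ρ.fixedPoints K ∧ x.2 = L x.1 := by
    intro x
    constructor
    · rintro ⟨w, hw, rfl⟩
      exact ⟨hw, rfl⟩
    · rintro ⟨h1, h2⟩
      exact ⟨x.1, h1, Prod.ext rfl h2.symm⟩
  have hΓK : Γ ≤ τ.fixedPoints K := by
    intro x hx
    obtain ⟨h1, h2⟩ := (hΓmem x).1 hx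
    exact (mem_fixedPoints_prod ρ σ K x).2 ⟨h1, h2 ▸ hLK _ h1⟩
  have hΓstab : ∀ g : G, ∀ x ∈ Γ, heckeOperator τ K g x ∈ Γ := by
    intro g x hx
    obtain ⟨h1, h2⟩ := (hΓmem x).1 hx
    rw [heckeOperator_prod_apply ρ σ K g (hfin g)]
    exact (hΓmem _).2 ⟨heckeOperator_apply_mem_fixedPoints ρ K g h1 (hfin g), by rw [h2, hL g _ h1]⟩
  -- its `G`-span `U`, a subrepresentation of `W ⊕ V` with `U^K = Γ`
  set U : Subrepresentation τ := ⟨Submodule.span k (⋃ g : G, τ g '' (Γ : Set (W × V))),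
    fun g x hx => map_span_translates_le τ Γ g (Submodule.mem_map_of_mem hx)⟩ with hU
  have hUeq : U.toSubmodule = Submodule.span k (⋃ g : G, τ g '' (Γ : Set (W × V))) := by rw [hU]
  have hUK : U.toSubmodule ⊓ τ.fixedPoints K = Γ := span_translates_inf_fixedPoints_of_stable τ K hfin hΓK hΓstab
  have hΓU : Γ ≤ U.toSubmodule := le_span_translates τ Γ
  -- the first projection `p : U → W` is onto (or `W^K = 0`)
  by_cases hWK : ρ.fixedPoints K = ⊥
  · refine ⟨0, fun w hw => ?_⟩
    rw [hWK, Submodule.mem_bot] at hw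
    subst hw
    rw [map_zero, map_zero]
  set p : U.toSubmodule →ₗ[k] W := (LinearMap.fst k W V).comp U.toSubmodule.subtype with hp
  have hprange : ∀ g : G, ∀ w ∈ LinearMap.range p, ρ g w ∈ LinearMap.range p := by
    rintro g _ ⟨u, rfl⟩
    exact ⟨⟨τ g u, U.apply_mem_toSubmodule g u.2⟩, rfl⟩
  obtain ⟨R, hR⟩ : ∃ R : Subrepresentation ρ, R.toSubmodule = LinearMap.range p := ⟨⟨_, hprange⟩, rfl⟩
  have hRtop : R = ⊤ := by
    refine (IsSimpleOrder.eq_bot_or_eq_top R).resolve_left fun hbot => hWK ?_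
    rw [eq_bot_iff]
    intro w hw
    have hwR : w ∈ R.toSubmodule := hR ▸ ⟨⟨(w, L w), hΓU ((hΓmem _).2 ⟨hw, rfl⟩)⟩, rfl⟩
    rw [hbot] at hwR
    exact hwR
  have hpsurj : Function.Surjective p := by
    rw [← LinearMap.range_eq_top, ← hR, hRtop]
    rfl
  -- its kernel is `0 ⊕ V′` with `V′` a subrepresentation of `V` without `K`-fixed vectors
  set V' : Subrepresentation σ := ⟨U.toSubmodule.comap (LinearMap.inr k W V), fun g v hv => by
    change ((0 : W), σ g v) ∈ U.toSubmodule
    have := U.apply_mem_toSubmodule g hv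
    simpa [hτ] using this⟩ with hV'
  have hV'K : V'.toSubmodule ⊓ σ.fixedPoints K = ⊥ := by
    rw [eq_bot_iff]
    rintro v ⟨hvU, hvK⟩
    have hmem : ((0 : W), v) ∈ U.toSubmodule ⊓ τ.fixedPoints K :=
      ⟨hvU, (mem_fixedPoints_prod ρ σ K _).2 ⟨Submodule.zero_mem _, hvK⟩⟩
    rw [hUK, hΓmem] at hmem
    rw [Submodule.mem_bot]
    simpa using hmem.2
  -- `S = k[G]·L(W^K)`, a subrepresentation of `V` containing every second coordinate of `U`, in particular `V′`
  set S : Submodule k V := Submodule.span k (⋃ g : G, σ g '' (((ρ.fixedPoints K).map L : Submodule k V) : Set V)) with hS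
  have hSG : ∀ g : G, ∀ s ∈ S, σ g s ∈ S := fun g s hs => map_span_translates_le σ _ g (Submodule.mem_map_of_mem hs)
  have hLS : ∀ w ∈ ρ.fixedPoints K, L w ∈ S := fun w hw =>
    Submodule.subset_span (Set.mem_iUnion.2 ⟨1, L w, ⟨w, hw, rfl⟩, by rw [map_one, Module.End.one_apply]⟩)
  have hUS : ∀ u ∈ U.toSubmodule, (u : W × V).2 ∈ S := by
    have hle : U.toSubmodule ≤ S.comap (LinearMap.snd k W V) := by
      rw [hUeq]
      refine Submodule.span_le.2 fun x hx => ?_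
      obtain ⟨g, hxg⟩ := Set.mem_iUnion.1 hx
      obtain ⟨γ, hγ, rfl⟩ := hxg
      obtain ⟨h1, h2⟩ := (hΓmem γ).1 hγ
      have h3 : (τ g γ).2 = σ g γ.2 := by simp [hτ]
      change (τ g γ).2 ∈ S
      rw [h3, h2]
      exact hSG g _ (hLS _ h1)
    exact fun u hu => hle hu
  have hV'S : V'.toSubmodule ≤ S := fun v hv => hUS _ hv
  -- KEY: `V′ = 0`, levelwise
  have hV'bot : V'.toSubmodule = ⊥ := by
    rw [eq_bot_iff]
    intro v hv
    obtain ⟨K', hK', hvK'⟩ := hsm v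
    -- `N := V′ ∩ V^{K′}` is Hecke-stable; take a Hecke-stable complement `C` in `V^{K′}`
    have hNst : ∀ g : G, ∀ n ∈ V'.toSubmodule ⊓ σ.fixedPoints K',
        heckeOperator σ K' g n ∈ V'.toSubmodule ⊓ σ.fixedPoints K' := by
      rintro g n ⟨hnV, hnK⟩
      refine ⟨?_, heckeOperator_apply_mem_fixedPoints σ K' g hnK (h𝓛fin K' hK' g)⟩
      rw [heckeOperator_apply_eq_sum_out σ K' g (h𝓛fin K' hK' g) hnK]
      exact Submodule.sum_mem _ fun α _ => V'.apply_mem_toSubmodule _ hnV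
    obtain ⟨C, hCK, hCst, hNC, hNCsup⟩ := hss K' hK' _ inf_le_right hNst
    -- `K` acts on `V^{K′}` and on `C` through the Hecke operators of its elements (which normalise `K′`)
    have hKfix : ∀ c ∈ K, ∀ x ∈ σ.fixedPoints K', σ c x ∈ σ.fixedPoints K' := fun c hc x hx => by
      rw [← heckeOperator_apply_of_forall_mem σ (h𝓛n K' hK' c hc) hx]
      exact heckeOperator_apply_mem_fixedPoints σ K' c hx (h𝓛fin K' hK' c)
    have hKC : ∀ c ∈ K, ∀ x ∈ C, σ c x ∈ C := fun c hc x hx => by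
      rw [← heckeOperator_apply_of_forall_mem σ (h𝓛n K' hK' c hc) (hCK hx)]
      exact hCst c x hx
    -- `S^K ⊆ C`: the `N`-component of a `K`-fixed vector of `S` is `K`-fixed, hence in `V′^K = 0`
    have hSKC : S ⊓ σ.fixedPoints K ≤ C := by
      rintro s ⟨-, hsK⟩
      have hsK' : s ∈ σ.fixedPoints K' := Representation.fixedPoints_antitone σ (h𝓛K K' hK') hsK
      have hs : s ∈ V'.toSubmodule ⊓ σ.fixedPoints K' ⊔ C := by rw [hNCsup]; exact hsK'
      obtain ⟨n, hn, c, hc, hnc⟩ := Submodule.mem_sup.1 hs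
      have hnK : n ∈ σ.fixedPoints K := by
        rw [Representation.mem_fixedPoints]
        intro c₀ hc₀
        have h1 : σ c₀ n + σ c₀ c = n + c := by
          rw [← map_add, hnc]
          exact (σ.mem_fixedPoints K s).1 hsK c₀ hc₀
        have hdiff : σ c₀ n - n ∈ V'.toSubmodule ⊓ σ.fixedPoints K' :=
          Submodule.sub_mem _ ⟨V'.apply_mem_toSubmodule c₀ hn.1, hKfix c₀ hc₀ n hn.2⟩ hn
        have hdiff' : σ c₀ n - n ∈ C := by
          have heq : σ c₀ n - n = c - σ c₀ c := by
            rw [sub_eq_sub_iff_add_eq_add, h1, add_comm]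
          rw [heq]
          exact Submodule.sub_mem _ hc (hKC c₀ hc₀ c hc)
        have h0 : σ c₀ n - n ∈ V'.toSubmodule ⊓ σ.fixedPoints K' ⊓ C := ⟨hdiff, hdiff'⟩
        rw [hNC, Submodule.mem_bot, sub_eq_zero] at h0
        exact h0
      have hn0 : n = 0 := by
        have : n ∈ V'.toSubmodule ⊓ σ.fixedPoints K := ⟨hn.1, hnK⟩
        rwa [hV'K, Submodule.mem_bot] at this
      rw [← hnc, hn0, zero_add]
      exact hc
    -- `T := C ∩ S^{K′}` is Hecke-stable and contains `L(W^K)`, so `S ⊆ k[G]·T` and `S^{K′} ⊆ T`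
    have hTK : C ⊓ (S ⊓ σ.fixedPoints K') ≤ σ.fixedPoints K' := fun x hx => hCK hx.1
    have hTst : ∀ g : G, ∀ x ∈ C ⊓ (S ⊓ σ.fixedPoints K'), heckeOperator σ K' g x ∈ C ⊓ (S ⊓ σ.fixedPoints K') := by
      rintro g x ⟨hxC, hxS, hxK⟩
      refine ⟨hCst g x hxC, ?_, heckeOperator_apply_mem_fixedPoints σ K' g hxK (h𝓛fin K' hK' g)⟩
      rw [heckeOperator_apply_eq_sum_out σ K' g (h𝓛fin K' hK' g) hxK]
      exact Submodule.sum_mem _ fun α _ => hSG _ _ hxS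
    have hST : S ≤ Submodule.span k (⋃ g : G, σ g '' (((C ⊓ (S ⊓ σ.fixedPoints K')) : Submodule k V) : Set V)) := by
      rw [hS]
      refine Submodule.span_mono (Set.iUnion_mono fun g => Set.image_mono ?_)
      rintro _ ⟨w, hw, rfl⟩
      have hLwS : L w ∈ S := hLS w hw
      exact ⟨hSKC ⟨hLwS, hLK w hw⟩, hLwS, Representation.fixedPoints_antitone σ (h𝓛K K' hK') (hLK w hw)⟩
    have hvT : v ∈ C ⊓ (S ⊓ σ.fixedPoints K') := by
      have h1 : v ∈ Submodule.span k (⋃ g : G, σ g '' (((C ⊓ (S ⊓ σ.fixedPoints K')) : Submodule k V) : Set V)) ⊓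
          σ.fixedPoints K' := ⟨hST (hV'S hv), hvK'⟩
      rwa [span_translates_inf_fixedPoints_of_stable σ K' (h𝓛fin K' hK') hTK hTst] at h1
    have h2 : v ∈ V'.toSubmodule ⊓ σ.fixedPoints K' ⊓ C := ⟨⟨hv, hvK'⟩, hvT.1⟩
    rw [hNC] at h2
    exact h2
  -- `F := snd : U → V` kills `ker p` (= `0 ⊕ V′ = 0`), hence factors through `p`
  set F : U.toSubmodule →ₗ[k] V := (LinearMap.snd k W V).comp U.toSubmodule.subtype with hF
  have hkerF : LinearMap.ker p ≤ LinearMap.ker F := by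
    intro u hu
    rw [LinearMap.mem_ker] at hu ⊢
    have hu2 : (u : W × V).2 ∈ V'.toSubmodule := by
      change ((0 : W), (u : W × V).2) ∈ U.toSubmodule
      have : (u : W × V) = ((0 : W), (u : W × V).2) := Prod.ext hu rfl
      rw [← this]
      exact u.2
    rw [hV'bot, Submodule.mem_bot] at hu2
    simpa only [hF, LinearMap.coe_comp, Function.comp_apply, Submodule.coe_subtype, LinearMap.snd_apply] using hu2
  set f₀ : W →ₗ[k] V := ((LinearMap.ker p).liftQ F hkerF).comp (p.quotKerEquivOfSurjective hpsurj).symm.toLinearMap with hf₀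
  have hf₀p : ∀ u : U.toSubmodule, f₀ (p u) = F u := by
    intro u
    simp only [hf₀, LinearMap.coe_comp, Function.comp_apply, LinearEquiv.coe_toLinearMap,
      LinearMap.quotKerEquivOfSurjective_symm_apply, Submodule.liftQ_apply]
  -- `f₀` is an intertwiner
  have hf₀G : ∀ (g : G) (w : W), f₀ (ρ g w) = σ g (f₀ w) := by
    intro g w
    obtain ⟨u, rfl⟩ := hpsurj w
    have hgu : ρ g (p u) = p ⟨τ g u, U.apply_mem_toSubmodule g u.2⟩ := by
      simp [hp, hτ]
    rw [hgu, hf₀p, hf₀p]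
    simp only [hF, LinearMap.coe_comp, Function.comp_apply, Submodule.coe_subtype, LinearMap.snd_apply]
    simp [hτ]
  refine ⟨f₀.intertwiningMap_of_isIntertwiningMap ρ σ hf₀G, fun w hw => ?_⟩
  -- on `W^K`: `(w, Lw) ∈ U`
  have hwU : (w, L w) ∈ U.toSubmodule := hΓU ((hΓmem _).2 ⟨hw, rfl⟩)
  have hpw : p ⟨(w, L w), hwU⟩ = w := rfl
  rw [LinearMap.toIntertwiningMap, ← hpw, hf₀p]
  simp only [hF, LinearMap.coe_comp, Function.comp_apply, Submodule.coe_subtype, LinearMap.snd_apply]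
  rfl

end Levelwise

end Literature.NumberTheory.Automorphic
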